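import Summits.BirchSwinnertonDyer.Rank1Residual.X11b.Three.HsiehDescent
import HarnessLib

/-!
# X11b @ `p = 3`, S28-a 'COMMON FRAME': the (W₃)-READING of the descent node —
# `HsiehCommonFrameAt₃ W` (ONE `@[conjecture] def`) and the PROVED glue
# `hval → (K2) → (K2a) → HsiehCommonFrameAt₃ W → HsiehDescentAt₃ W`, with its LOSSLESS converse

HONEST FRAMING (cell `b2b-bsdres`, run/shared/lean/b2b/bsd-rank1-residual/, verbatim in every
file): the goal of the cell is to DELETE the COMBINATION-SHAPED residual classes of the
Birch–Swinnerton-Dyer formula for ALL analytic-rank `≤ 1` elliptic curves over `ℚ` — assembled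
STRICTLY from published theorems — so that the rank-`≤ 1` remainder becomes exactly the
CONSTRUCTION-SHAPED classes, which are TYPED, NOT attempted. This is not "finishing BSD". Team N8/O2
(X11b at `3`: `3 ‖ N`, `r_an = 1`, `E[3]` irreducible): research route; nothing booked; NO label
changes; O2 stays OPEN. THEOREMS + ONE `@[conjecture]`-tagged named statement (an obligation node
stated in our theories — NOT a vendored fact, NOT asserted); no `sorry`; fact debt `0`.

PROVENANCE: sub-target S28 'COMMON-FRAME RE-EXPRESSION OF THE DESCENT NODE' (OWNERS R8-18 / R8-22 /
R8-24 (iii) / R8-28 / R8-30 (c) / R8-32 / R8-34, lead x11b3 GEN 7). TYPING OF RECORD = x11b3-r1 GEN 8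
`HOME/b2b-bsdres-x11b3-r1/S28-SKETCH.lean` v2 1fda07b0dc9b116c → v3 c293da618d8d8fa5 (the ring line of
R8-32 = r2's X4 OPTION (a)) → `S28-SKETCH-v4-READY.lean` a601c7d861544f3e (v3 VERBATIM + §6, the
`hval` discharge by import of multr1-p1's `X11b/UnrIntegersValuationRing.lean` p266190, R8-34 (b));
feasibility S28-0 = x11b3-r2 `cells/x11b3/S28-K1-CHECK.md` (PASS, R8-22);
x11b3-r2 GEN 9 pre-read `gen9/S28a-PREREAD-r2.md` d9440d2bd6f4ca49 and XS cross-read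
`gen9/S28a-XREAD-r2.md` 31efb36efbfc8583 (PASS, notes N1–N6 non-blocking); kernel inputs multr1-p1
`X11b/KummerTwistIntersectionPadic.lean` (p263901) and x11b3-p4 `X11b/KummerRadicalIntersection.lean` /
`KummerValuationInputs.lean` (p264085 / p264420, the alternative road); lit1 LIT-TABLE L59–L66, lit2
second reads (page locators of record). FILING HAND: seat `b2b-bsdres-x11b3-p3` (gen. 6; plan INBOX
11:47:50Z, lead-approved; r2 GEN 10 byte re-check `gen10/S28a-RECHECK-r2.md` e153e2e156e08ef3 = GO) —
r1's v4-READY declarations (statements AND proofs) BYTE-IDENTICAL: §1–§4 = v3 as cross-read, §6 = two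
PROVED additions (no v3 declaration touched), §5 NOT FILED and one docstring line of §4 re-pointed from
§5 to p2's tree lemma (r2 N7); this module docstring = r1's with the sketch title replaced by this header.

Deal S28 'COMMON FRAME' = the (W₃)+(n1)-shaped RE-EXPRESSION of the λ-free conjunct (t) of the Hsieh
frame residual at `p = 3 ‖ N`. WORDING OF RECORD (R8-18, H45): S28 RE-EXPRESSES (t) GIVEN printed
(n1) + kernel field theory; the open content is the common-frame statement `HsiehCommonFrameAt₃ W`
below, CONSTRUCTION-LEVEL (Hsieh's `𝒫_Σ(π,λ)²` built over `𝓦_λ = W(𝔽̄₃)[λ-values]` for EVERY admissible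
`λ`, with the printed twist-compatibility Prop. 5.5); NOTHING SHRINKS; `Three.HsiehDescentAt₃ W` STAYS
THE NODE OF RECORD. This programme (0 sorry, ONE def) is filed as TWO files by topic (tree lint: ≤ 400
lines each): THIS FILE = §1–§3 (the node, the abstract glue, the lossless converse, the calibration);
`Three/HsiehCommonFrameGlue.lean` = §4 + §6 (the glue OF RECORD, the `hval` discharge; r1's §5 not filed):
* §1 the ONE `@[conjecture] def HsiehCommonFrameAt₃ W`;
* §2 abstract glue PROVED: (K1) ∧ common frame ⟹ descent (`hsiehDescentAt₃_of_commonFrame_of_inter`,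
  binder `hK1` = (K1) VERBATIM); §3 descent ⟹ common frame OUTRIGHT (`hsiehCommonFrameAt₃_of_descent`:
  the re-expression is LOSSLESS modulo the theorem (K1)); calibration from framewise H1;
* §4 THE GLUE OF RECORD (R8-24 (iii) / R8-28 / R8-32): (K1) PROVED (`inter_subset_unrIntegers_of_supplies`)
  from the ONE labelled infrastructure binder `hval` = (DISC) ∧ (U-c) (lit1 l.3829 (a) / p4 l.684
  wording VERBATIM) and the two NAMED theorem targets (K2), (K2a), in the SUBFIELD currency
  `𝔎₃ = Subfield.closure (unrIntegers 3)` so that multr1-p1's landed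
  `R1.mem_subfield_padic_of_forall_mem_closure` (`X11b/KummerTwistIntersectionPadic.lean`) applies
  VERBATIM (ROAD DEFAULT, R8-30 (c)); and
  `hsiehDescentAt₃_of_commonFrame : hval → (K2) → (K2a) → HsiehCommonFrameAt₃ W → HsiehDescentAt₃ W`.
  The binders ARE the signatures of record: `hval` (infrastructure; lit1's `UnrIntegersUnits.lean` (U)
  and p4's memo R8-28 (b) discharge it by name), (K2) = S28-c (p2 GEN 4: one assembly lemma with
  signature = `hK2` VERBATIM, r2 N6), (K2a) = r2's (K3) (owner S28-c; p7 candidate, GLOBAL route);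
* §5 (r1's courtesy lemma `exists_padicAlgCl_coe_eq_of_pow_eq_one`: a `3^a`-th root of unity of `ℂ₃` comes
  from `ℚ̄₃`, the bridge between p2's (K2-e) (`η : PadicAlgCl 3`) and `hK2` (`η : ℂ₃`)) is NOT FILED here: it is
  in the tree as x11b3-p2's `LambdaSupply.exists_padicAlgCl_coe_eq_of_pow_eq_one` (p266624; r2 N7);
* §6 (filing hand's plan, R8-34 (b); bytes r1's v4-READY) `hval` DISCHARGED BY IMPORT:
  `fracUnr_discrete_and_valuationRing₃ : hval` from multr1-p1's `X11b/UnrIntegersValuationRing.lean`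
  (p266190: `R1.exists_norm_eq_zpow_of_mem_fracUnr`, `R1.mem_unrIntegers_of_mem_fracUnr`), and the
  `hval`-FREE glue of record `hsiehDescentAt₃_of_commonFrame_of_supplies : (K2) → (K2a) →
  HsiehCommonFrameAt₃ W → HsiehDescentAt₃ W` — after which the glue's binders are exactly the two theorem
  targets in flight ((K2): x11b3-p2 `LambdaSupplyTwistFamily.lean` p265205 + `LambdaSupplyTwistOrbit.lean`
  p266140; (K2a): x11b3-p7, R8-33 (c)) plus the node.
HONEST FRAMING: nothing asserted, nothing booked, no mark / label / count moves; H2 at `3 ‖ N` not in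
print; O2 OPEN; X11 ∧ r = 1 ∧ p = 3 CONSTRUCTION-SHAPED.

## Dictionary
* `R₀ = unrIntegers 3` (closure of `ℤ[μ_{3'}]` in `ℂ₃` = `𝒪(ℚ̂₃^{ur})`); `𝔎₃ := Subfield.closure R₀ ⊂ ℂ₃`
  (`= Frac R₀`; file-local notation, no def).
* For an admissible `(λ, r_λ)` (the six clauses of `hsieh2014_exists_anticyclotomicPAdicLFunction` /
  S24-a `Three.lambdaSupplyAt₃` p264661, VERBATIM) the COEFFICIENT FIELD AT `γ`
  `F_λ := Subfield.closure (R₀ ∪ {avatarValueAt r_λ γ})` (inline; no def). In nature `F_λ = 𝔎₃(r_λ(γ))`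
  is finite over the complete field `𝔎₃`, hence complete, hence CONTAINS Hsieh's closed ring
  `𝒲_λ = W(𝔽̄₃)[λ̂(Γ_K)]⁻` (`r_λ(Γ_K) = r_λ(γ)^{ℤ₃}`) and v2's `A_λ`: the v3 node asserts LESS (bigger
  ring; implied by the v2 node through the TRUE containment (A-cl)), is still construction-level
  'nearly printed', and its glue needs neither closedness nor continuity items (r2
  `gen9/S28a-PREREAD-r2.md` §2, `gen9/S28a-XREAD-r2.md` X4; lit1 L59 (B); `cells/x11b3/S28-K1-CHECK.md`).
* (K1)  TWIST INTERSECTION: `𝒪_{ℂ₃} ∩ ⋂_{λ admissible} F_λ ⊆ R₀` — binder `hK1` of §2 VERBATIM (now with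
  `γ`), and the CONCLUSION of §4's `inter_subset_unrIntegers_of_supplies` (PROVED there from `hval`,
  (K2), (K2a) — no seat's end theorem).
* `hval` = (DISC) `∀ x ∈ 𝔎₃, x ≠ 0 → ∃ n : ℤ, ‖x‖ = 3 ^ n` ∧ (U-c) `∀ x ∈ 𝔎₃, ‖x‖ ≤ 1 → x ∈ unrIntegers 3`
  (R8-28 (a): ONE labelled binder; (h_ζ) follows from (DISC), `R1.pow_eq_one_imp_eq_one_of_norm_zpow`).
* (K2)  TWIST SUPPLY (S28-c, p2): every admissible `(λ, r_λ)` may be twisted at `γ` by every `η ∈ ℂ₃`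
  with `η^{3^a} = 1` and stays admissible (= (K2-a) `twist_admissible` + (K2-e)
  `exists_admissible_twist_of_pow_eq_one` (R8-30 (d)) + multiplicativity of `avatarValueAt` + the
  root-of-unity lift; in the tree as ONE decl `LambdaSupply.twistSupply₃` = `hK2` VERBATIM, p266624).
* (K2a) RADICAL-VALUE SUPPLY (= r2's (K3) 'radicality of a base avatar value'; owner S28-c, p7
  candidate): some admissible `(λ₁, r₁)` has `r₁(γ)^{3^a} = u`, `0 ≠ u ∈ 𝔎₃`. TRUE but NOT derivable
  from `IsPAdicAvatarOf` + `FactorsThroughZp` alone (`IsPAdicAvatarOf` sees `v ∤ 3` only) — WITH the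
  Hecke-side clauses it is an M-sized theorem (r2 X5 correction). Route in nature (GLOBAL, endorsed by
  r2 X5 over the local [T1]–[T3]): `λ(ϖ_v)^{h_K·w} ∈ K ⊂ ℚ₃` for `v ∤ 3𝔣` (`3` split), Frobenii are
  dense (`absoluteGaloisGroup.subgroup_eq_top_of_isClosed_of_frobenius_mem`, the lemma behind
  `eq_of_isPAdicAvatarOf` of `X11b/Three/LambdaSupplyTransport.lean`), so `r(σ)^{h_K w} ∈ ℚ₃` on
  `Γ_K`; strip the prime-to-`3` part of the exponent inside the principal units. No local–global
  compatibility at `𝔭`. Existence of an admissible pair = S24-a p264661.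

## Typing decisions (r1; r2 cross-read X1–X9 PASS on v2, re-check of the v3 bytes pending)
(T1) the common frame's period is typed `Ωp' : (unrIntegers 3)ˣ` — the TARGET's currency — rather
than '`‖Ωp'‖ = 1 ∧ Ωp' ∈ F_λ`': (t2) `Ω_p ∈ R₀ˣ` is PRINTED (de Shalit 1987 II.4.11 Remark (iii);
Castella–Hsieh 2018 §2.5: the CM period lies in `𝒲^× = W(𝔽̄_p)^×`), so no unit lemma enters the glue
(r2 X6 ✓); (T2) `C = 1` and the SAME `A` (re-normalised frame, as in `HsiehDescentAt₃`'s consequent);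
(T3) the ring is the SUBFIELD `F_λ` at the point `γ`, NO topological closure (R8-32 option (a)); the
`∀λ` clause does not need the closure (§2–§4 are closure- and continuity-free); (K1) carries the
integrality binder `x ∈ 𝒪_{ℂ₃}` (free for the consumer: `Q'` is typed over `PadicComplexInt 3`);
(U-c) is consumed in NORM currency as ruled (`‖x‖ ≤ 1` from membership by
`Valuation.mem_valuationSubring_iff` + `PadicComplex.norm_eq_norm`, proved inline); (T4) every target
is stated under S24-a's binders (`ι'`, `K` imaginary quadratic, `3` split, `κ` anticyclotomic, `γ` a
topological generator) — where the supply holds; (K1) would be FALSE over an empty admissible family,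
so it is meaningful ONLY together with S24-a (`Three.lambdaSupplyAt₃`, p264661 ACCEPTED); (T5) roots
of unity `η` are typed in `ℂ₃` (not `ℚ̄₃`) so the consumer matches the Kummer lemma's `hy` verbatim
(p2's `LambdaSupply.exists_padicAlgCl_coe_eq_of_pow_eq_one` lifts them to `ℚ̄₃`). CONTEXT (R8-30 (f)): multr1-p2's `X11b/HsiehFrameUniqueness.lean`
(p264599; fixed-data uniqueness of a frame given a supply, every `p`) — cited, not used.
-/

noncomputable section

open scoped Classical

open WeierstrassCurve NumberField IsDedekindDomain Field PowerSeries
  Literature.NumberTheory.EllipticCurves Literature.NumberTheory.EllipticCurves.ModularForms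
  Literature.NumberTheory.EllipticCurves.Rank1Residual
  Literature.NumberTheory.GaloisRepresentations Literature.NumberTheory.Automorphic

namespace Summit.BirchSwinnertonDyer.Rank1Residual.X11b.Three

/-! ### §1 The node (S28-a): ONE `@[conjecture] def` (v2 with the ring line of R8-32) -/

section Node

variable (W : WeierstrassCurve ℚ) [W.IsElliptic] [W.IsGloballyMinimal]

/-- **`HsiehCommonFrameAt₃ W` — "(W₃)+(n1): ONE re-normalised Hsieh frame whose coefficients lie in
`F_λ` for EVERY admissible `λ`"** (S28-a; hypothesis-shaped; the datum binders and the Hsieh-witness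
trigger of `HsiehDescentAt₃ W` VERBATIM). For every Hsieh witness `(A, Ω_K, C, Ω_p, Q)` at an S22
datum there are `Ω_K' ≠ 0`, `Ω_p' ∈ R₀ˣ` and `Q' ∈ 𝒪_{ℂ₃}⟦T⟧` with
`IsHsiehLFunction ι' 𝔭 κ γ f A Ω_K' 1 Ω_p' Q'` (Hsieh's display with `C = 1`) such that for EVERY
admissible `(λ, r_λ)` — unitary, infinity type `(1,−1)`, trivial on `𝔸_ℚ^×`, unramified outside `3`,
`r_λ` its `3`-adic avatar through `κ` (the six clauses of `hsieh2014_exists_anticyclotomicPAdicLFunction`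
verbatim) — every coefficient of `Q'` lies in `F_λ = Subfield.closure (R₀ ∪ {r_λ(γ)})`, the subfield of
`ℂ₃` generated by `R₀` and the value `λ̂(γ)` — no topological closure (R8-32) — so that the descent glue
is the tree's field-theoretic `R1.mem_subfield_padic_of_forall_mem_closure`; that subfield is complete
(finite over `Frac R₀`) and contains Hsieh's `𝒲_λ = W(𝔽̄₃)[λ̂]`. Printed support (page locators of
record, lit2 second read / R8-25 (b), arXiv:1112.1580): the twist-compatibility
`𝒫_Σ(π,λε) = Tw_ε 𝒫_Σ(π,λ)` Prop. 5.5 [p. 23 L40–L46]; `𝒫_Σ(π,λ)` and the periods [p. 23 L63–L64];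
Thm. 5.6 / `C(π,λ)` [p. 23 L66–L69]; Thm. 6.1 [p. 25 L23–L25] with proof ¶1 [p. 25 L27] ('defined over
`𝒪_L`', `L/ℚ_p` finite CHOSEN PER `λ` — the construction runs over `𝓦_λ` for EACH admissible `λ` (n1))
and [p. 25 L38–L41]: the frames are identified ACROSS `λ` only at construction level — the COMMON
frame is NOT a printed statement at `3 ∣ N` (W₃). With the twist-intersection theorem (K1)
`𝒪_{ℂ₃} ∩ ⋂_λ F_λ ⊆ R₀` (§4) it implies `HsiehDescentAt₃ W` (`hsiehDescentAt₃_of_commonFrame`), and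
`HsiehDescentAt₃ W` implies it outright (`hsiehCommonFrameAt₃_of_descent`). NOTHING SHRINKS (H45):
`HsiehDescentAt₃ W` stays the node of record; this is its (W₃)-reading. TYPED, not attempted.
[cite: Hsieh2014, Prop. 5.5, Thm. 5.6 (arXiv:1112.1580 p. 23) and Thm. 6.1 with proof ¶1 (p. 25) (construction over 𝒪_L per λ; the common R₀-frame at 3 ∣ N is NOT in print)]
[cite: deShalit1987, II.4.11 Remark (iii) (p. 66) ((t2): Ω_p a unit of the completion of ℤ_p^ur)]
[cite: CastellaHsieh2018, Def. 3.5 and Prop. 3.6 (arXiv:1505.08165 pp. 10–11) (shape of the consequent, printed for p ∤ N)] -/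
@[conjecture]
def HsiehCommonFrameAt₃ : Prop :=
  ∀ (ι' : PadicAlgCl 3 ≃+* ℂ) (K : Type) [Field K] [NumberField K]
    (𝔭 : HeightOneSpectrum (𝓞 K)) (κ : ZpExtension K 3) (γ : Field.absoluteGaloisGroup K)
    {N : ℕ} [NeZero N] {f : CuspForm (CongruenceSubgroup.Gamma0 N) 2}, IsNewformOf W f →
    ClassX11b W 3 → Surj W 3 → W.conductorNorm ℤ = N → IsImaginaryQuadratic K →
    Odd (NumberField.discr K) → SatisfiesHeegnerHypothesis N K →
    ((Ideal.span {(3 : ℤ)}).primesOver (𝓞 K)).ncard = 2 → ((3 : ℕ) : 𝓞 K) ∈ 𝔭.asIdeal →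
    𝔭.asIdeal.ramificationIdx (𝓞 ℚ) = 1 → 𝔭.asIdeal.inertiaDeg (𝓞 ℚ) = 1 →
    (∀ (w : InfinitePlace K) (k : 𝓞 K), k ∈ 𝔭.asIdeal ↔ ‖ι'.symm (w.embedding (k : K))‖ < 1) →
    (∀ ℓ : ℕ, ℓ.Prime → ℓ ∣ N → ∃ v : HeightOneSpectrum (𝓞 K), Ideal.absNorm v.asIdeal = ℓ) →
    κ.IsAnticyclotomic → κ.IsTopGenerator γ →
    ∀ (A : ℝ) (ΩK C : ℂ) (Ωp : ℂ_[3]) (Q : PowerSeries (PadicComplexInt 3)),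
      0 < A → ΩK ≠ 0 → ‖((ι'.symm C : PadicAlgCl 3) : ℂ_[3])‖ = 1 → ‖Ωp‖ = 1 →
      IsHsiehLFunction ι' 𝔭 κ γ f A ΩK C Ωp Q →
      ∃ (ΩK' : ℂ) (Ωp' : (unrIntegers 3)ˣ) (Q' : PowerSeries (PadicComplexInt 3)), ΩK' ≠ 0 ∧
        IsHsiehLFunction ι' 𝔭 κ γ f A ΩK' 1 ((Ωp' : unrIntegers 3) : ℂ_[3]) Q' ∧
        ∀ (lam : HeckeCharacter K) (rlam : FramedGaloisRep K (PadicAlgCl 3) 1),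
          lam.IsUnitary → lam.HasInfinityType (fun _ ↦ (1 : ℤ)) (fun _ ↦ (-1 : ℤ)) →
          (∀ x : ideleGroup ℚ, lam (AdeleRing.ideleBaseChange ℚ K x) = 1) →
          (∀ v : HeightOneSpectrum (𝓞 K), ((3 : ℕ) : 𝓞 K) ∉ v.asIdeal → lam.IsUnramifiedAt v) →
          IsPAdicAvatarOf ι' lam rlam → FactorsThroughZp κ rlam →
          ∀ k : ℕ, ((PowerSeries.coeff k Q' : PadicComplexInt 3) : ℂ_[3]) ∈
            Subfield.closure ((unrIntegers 3 : Set ℂ_[3]) ∪ {avatarValueAt rlam γ})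

end Node

/-! ### §2 The abstract glue: common frame ∧ (K1) ⟹ descent — PROVED; `hK1` = (K1) VERBATIM -/

section Glue

variable (W : WeierstrassCurve ℚ) [W.IsElliptic] [W.IsGloballyMinimal]

omit [W.IsElliptic] [W.IsGloballyMinimal] in
/-- **Abstract glue: `(K1) ∧ HsiehCommonFrameAt₃ W ⟹ HsiehDescentAt₃ W`.** The hypothesis `hK1` is the
twist intersection (K1): at every `(ι', K, κ, γ)` with `K` imaginary quadratic, `3` split, `κ`
anticyclotomic and `γ` a topological generator of `κ`, an element of `𝒪_{ℂ₃}` lying in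
`F_λ = Subfield.closure (R₀ ∪ {r_λ(γ)})` for EVERY admissible `(λ, r_λ)` lies in `R₀` ((K1) is PROVED in
§4 from the labelled binder `hval` and the two named targets: `inter_subset_unrIntegers_of_supplies`;
the glue OF RECORD is §4's `hsiehDescentAt₃_of_commonFrame`).
Proof: read `Q'` coefficientwise in `R₀⟦T⟧` (`IntSeries.hasValueAt_iff_of_coeff_eq`); the display is
already the target's (`C = 1`, `Ω_p' ∈ R₀ˣ`) — equivalently p3's `hsiehDisplayFrame_of_coeff_mem` with
`h3 := ⟨1, _⟩` (r2 (F3)). [cite: Castella2018, §2.2 (arXiv:1704.06608 p. 5) (the two receptacles differ only by the coefficient ring)] -/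
theorem hsiehDescentAt₃_of_commonFrame_of_inter
    (hK1 : ∀ (ι' : PadicAlgCl 3 ≃+* ℂ) (K : Type) [Field K] [NumberField K] (κ : ZpExtension K 3)
      (γ : absoluteGaloisGroup K), IsImaginaryQuadratic K →
      ((Ideal.span {(3 : ℤ)}).primesOver (𝓞 K)).ncard = 2 → κ.IsAnticyclotomic → κ.IsTopGenerator γ →
      ∀ x : ℂ_[3], x ∈ PadicComplexInt 3 →
      (∀ (lam : HeckeCharacter K) (rlam : FramedGaloisRep K (PadicAlgCl 3) 1),
        lam.IsUnitary → lam.HasInfinityType (fun _ ↦ (1 : ℤ)) (fun _ ↦ (-1 : ℤ)) →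
        (∀ y : ideleGroup ℚ, lam (AdeleRing.ideleBaseChange ℚ K y) = 1) →
        (∀ v : HeightOneSpectrum (𝓞 K), ((3 : ℕ) : 𝓞 K) ∉ v.asIdeal → lam.IsUnramifiedAt v) →
        IsPAdicAvatarOf ι' lam rlam → FactorsThroughZp κ rlam →
        x ∈ Subfield.closure ((unrIntegers 3 : Set ℂ_[3]) ∪ {avatarValueAt rlam γ})) →
      x ∈ unrIntegers 3)
    (hcf : HsiehCommonFrameAt₃ W) : HsiehDescentAt₃ W := by
  haveI : Fact (Nat.Prime 3) := ⟨Nat.prime_three⟩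
  intro ι' K _ _ 𝔭 κ γ N _ f hnf hX hsurj hN hK hodd hHeeg h3 h𝔭 he hf hι' hHeegC hκ hγ A ΩK C Ωp Q
    hA hΩK hC hΩp hQ
  obtain ⟨ΩK', Ωp', Q', hΩK', hQ', hcoef⟩ :=
    hcf ι' K 𝔭 κ γ hnf hX hsurj hN hK hodd hHeeg h3 h𝔭 he hf hι' hHeegC hκ hγ A ΩK C Ωp Q hA hΩK hC
      hΩp hQ
  have hmem : ∀ k : ℕ, ((PowerSeries.coeff k Q' : PadicComplexInt 3) : ℂ_[3]) ∈ unrIntegers 3 :=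
    fun k ↦ hK1 ι' K κ γ hK h3 hκ hγ _ (PowerSeries.coeff k Q').2 fun lam rlam h₁ h₂ h₃ h₄ h₅ h₆ ↦
      hcoef lam rlam h₁ h₂ h₃ h₄ h₅ h₆ k
  have hLQ : ∀ k : ℕ, ((PowerSeries.coeff k Q' : PadicComplexInt 3) : ℂ_[3]) =
      ((PowerSeries.coeff k (PowerSeries.mk fun k ↦ (⟨_, hmem k⟩ : unrIntegers 3)) :
        unrIntegers 3) : ℂ_[3]) := fun k ↦ by
    simp only [PowerSeries.coeff_mk]
  exact ⟨ΩK', Ωp', PowerSeries.mk fun k ↦ (⟨_, hmem k⟩ : unrIntegers 3), hΩK',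
    fun χ n hn hunr hinf r hr hfac ↦
      (IntSeries.hasValueAt_iff_of_coeff_eq hLQ _ _).mp (hQ' χ n hn hunr hinf r hr hfac)⟩

omit [W.IsElliptic] [W.IsGloballyMinimal] in
/-- **The re-expression is LOSSLESS on the other side: `HsiehDescentAt₃ W ⟹ HsiehCommonFrameAt₃ W`
OUTRIGHT** (an `R₀`-frame is a common frame: `R₀ ⊆ F_λ` for every `λ` (`Subfield.subset_closure`),
and `R₀ ⊆ 𝒪_{ℂ₃}` by `unrIntegers_le_padicComplexInt`). Hence, MODULO the theorem target (K1),
`HsiehCommonFrameAt₃ W` IS `HsiehDescentAt₃ W` — a reading, not a smaller target (H45). [cite: Castella2018, §3 (arXiv:1704.06608 p. 9) (R₀ ⊆ 𝒪_{ℂ_p})] -/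
theorem hsiehCommonFrameAt₃_of_descent (hdesc : HsiehDescentAt₃ W) : HsiehCommonFrameAt₃ W := by
  haveI : Fact (Nat.Prime 3) := ⟨Nat.prime_three⟩
  intro ι' K _ _ 𝔭 κ γ N _ f hnf hX hsurj hN hK hodd hHeeg h3 h𝔭 he hf hι' hHeegC hκ hγ A ΩK C Ωp Q
    hA hΩK hC hΩp hQ
  obtain ⟨ΩK', Ωp', L, hΩK', hdisp⟩ :=
    hdesc ι' K 𝔭 κ γ hnf hX hsurj hN hK hodd hHeeg h3 h𝔭 he hf hι' hHeegC hκ hγ A ΩK C Ωp Q hA hΩK hC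
      hΩp hQ
  have hmem : ∀ k : ℕ, ((PowerSeries.coeff k L : unrIntegers 3) : ℂ_[3]) ∈ PadicComplexInt 3 :=
    fun k ↦ (ValuationSubring.mem_toSubring _ _).mp
      (unrIntegers_le_padicComplexInt (PowerSeries.coeff k L).2)
  have hLQ : ∀ k : ℕ, ((PowerSeries.coeff k (PowerSeries.mk fun k ↦ (⟨_, hmem k⟩ :
      PadicComplexInt 3)) : PadicComplexInt 3) : ℂ_[3]) =
      ((PowerSeries.coeff k L : unrIntegers 3) : ℂ_[3]) := fun k ↦ by
    simp only [PowerSeries.coeff_mk]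
  refine ⟨ΩK', Ωp', PowerSeries.mk fun k ↦ (⟨_, hmem k⟩ : PadicComplexInt 3), hΩK',
    fun χ n hn hunr hinf r hr hfac ↦
      (IntSeries.hasValueAt_iff_of_coeff_eq hLQ _ _).mpr (hdisp χ n hn hunr hinf r hr hfac),
    fun lam rlam _ _ _ _ _ _ k ↦ ?_⟩
  rw [hLQ k]
  exact Subfield.subset_closure (Or.inl (PowerSeries.coeff k L).2)

omit [W.IsGloballyMinimal] in
/-- **Calibration (⇐), UNCONDITIONAL: framewise H1 ⟹ `HsiehCommonFrameAt₃ W`** (via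
`hsiehDescentAt₃_of_forall_exists_isBDPLFunction` and `hsiehCommonFrameAt₃_of_descent`): the new node
is AT MOST as strong as framewise H1 — the residual did not grow. Nothing asserted.
[cite: Castella2018, Thm. 3.1 (arXiv:1704.06608 p. 9) (binder shape only)] -/
theorem hsiehCommonFrameAt₃_of_forall_exists_isBDPLFunction
    (h : ∀ (ι' : PadicAlgCl 3 ≃+* ℂ) (K : Type) [Field K] [NumberField K]
      (𝔭 : HeightOneSpectrum (𝓞 K)) (κ : ZpExtension K 3) (γ : Field.absoluteGaloisGroup K)
      {N : ℕ} [NeZero N] {f : CuspForm (CongruenceSubgroup.Gamma0 N) 2}, IsNewformOf W f →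
      ClassX11b W 3 → Surj W 3 → W.conductorNorm ℤ = N → IsImaginaryQuadratic K →
      Odd (NumberField.discr K) → SatisfiesHeegnerHypothesis N K →
      ((Ideal.span {(3 : ℤ)}).primesOver (𝓞 K)).ncard = 2 → ((3 : ℕ) : 𝓞 K) ∈ 𝔭.asIdeal →
      𝔭.asIdeal.ramificationIdx (𝓞 ℚ) = 1 → 𝔭.asIdeal.inertiaDeg (𝓞 ℚ) = 1 →
      (∀ (w : InfinitePlace K) (k : 𝓞 K), k ∈ 𝔭.asIdeal ↔ ‖ι'.symm (w.embedding (k : K))‖ < 1) →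
      (∀ ℓ : ℕ, ℓ.Prime → ℓ ∣ N → ∃ v : HeightOneSpectrum (𝓞 K), Ideal.absNorm v.asIdeal = ℓ) →
      κ.IsAnticyclotomic → κ.IsTopGenerator γ →
      ∃ (ΩK : ℂ) (Ωp : (unrIntegers 3)ˣ) (L : UnrSeries 3),
        ΩK ≠ 0 ∧ IsBDPLFunction ι' 𝔭 κ γ f ΩK ((Ωp : unrIntegers 3) : ℂ_[3]) L) :
    HsiehCommonFrameAt₃ W :=
  hsiehCommonFrameAt₃_of_descent W (hsiehDescentAt₃_of_forall_exists_isBDPLFunction W h)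

end Glue

end Summit.BirchSwinnertonDyer.Rank1Residual.X11b.Three

end
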